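import Summits.QuantumAdvantage.AdviceFreeQNC0.AffBells29Laws
import HarnessLib

/-!
# Sketch29 v3, part 3/5 (planner qn-p1 g29, ROUND-28): §29.5 CLASS ISOLATION (`IsClassIso`, `Balanced`, `FreeMember`, `ClassIsoFM`, …), the UNBALANCED-CLASS WITNESS LEMMA (PROVED), and the corrected split `HCube` / conjectures `HClassA`, `HClassB` with the composition PROVED

(VERBATIM slice of `HOME/qa-qnc0-p1/exp29/Sketch29.lean` (sha16 `d7934601fa3f468f`, 1191 l., farm rc 0 / 0 sorry / 0 warnings), authored AND
proved by the planner seat qn-p1 g29; landed by the prover seat qn-prover-3 g14 (ask P-29b) as five files (400-line rule).  Changes: file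
boundaries with per-file preamble, one-line docstrings on undocumented auxiliaries (lint), and in part 1 the planner's re-proofs
`AffBells29.peeling/peelingList` are omitted in favour of the landed `AffBells28.peeling/peelingList` (gate dedup), as the ask allows.)
WHAT THIS IS NOT: `HClassA` (the one remaining c-free conjecture of the (NP₁) plan) is NOT touched; separation NOT moved.
-/

namespace Summit.QuantumAdvantage.AdviceFreeQNC0

namespace AffBells29

open Finset Literature.Computability.QuantumComplexity Literature.Computability.QuantumComplexity.RingHLF
open AffBells23 AffBells26 Fib19 AffBells27 AffBells28

variable {N : ℕ}

/-! ### §29.5 CLASS ISOLATION, the UNBALANCED-CLASS WITNESS LEMMA (PROVED), and the corrected A/B split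

A CLASS ISOLATION at `(x, C₀)` (c-free; a function of the kernel line and the window): a pattern point `x₁`, non-empty disjoint moves `L` inside
`C₀`, a reference survivor `g`, such that EVERY survivor is a local `±`-twin of `g` on the free coins `F = C₀ ∖ moveCoins L`, and a free pair
`r ≠ r'` that `g` sees non-degenerately (`dPair β x₁ g r r' ≠ 0`).  Write `U = surv`, `Δ_h := ε_h·(cShift_h − form β x₁ h)` (`ε_h = ±1` the
twin sign) and `grp t := #{h ∈ U : Δ_h = t}`.  **LEMMA (`cube_of_unbalanced`, PROVED): if the three numbers `grp 0, grp 1, grp 2` do NOT all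
have the same parity, `(x, C₀)` carries a cube witness** (at `x₁` the non-firing count is `|U| − grp 0`, at the partner `x₁ ⊕ {r,r'}` it is
`|U| − grp d`, `d ≠ 0`; both even forces all three `grp`'s `≡ |U|`).  COROLLARY (`cube_of_single`): a SINGLE survivor (`U = {g}`) is a cube
witness for EVERY `c` — pointwise, no probability.  (The landed one-class `AffBells28.HIsoA` asked instead for a THREE-valued leaf form, which on
`blockdiag√N` needs `Θ(log N)` coins in one `√N`-block: density `N^{-Θ(log N)}` under the UNIFORM window law — false as typed; see ROUND-28 §2.
With β-ADAPTED laws (§29.4) the host-row law puts all `Z` coins into one block and single isolation has constant density there.) -/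

/-- The data of a CLASS ISOLATION at the window `(x, C₀)` with a given NON-DEGENERATE FREE PAIR `(r, r')` (c-free). -/
def IsClassIsoPair (β : Fin N → Fin N → ZMod 3) (x : Fin N → Bool) (C₀ : Finset (Fin N)) (x₁ : Fin N → Bool) (L : List (Fin N × Fin N))
    (g r r' : Fin N) : Prop :=
  x₁ ∈ SubFibre x C₀ ∧ L ≠ [] ∧ MovesIn C₀ L ∧ g ∈ surv β x x₁ L ∧
    (∀ h ∈ surv β x x₁ L, LocTwin β (C₀ \ moveCoins L) h g ∨ LocAnti β (C₀ \ moveCoins L) h g) ∧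
    r ∈ C₀ \ moveCoins L ∧ r' ∈ C₀ \ moveCoins L ∧ r ≠ r' ∧ dPair β x₁ g r r' ≠ 0

/-- Twin sign of a survivor relative to `g` on the free coins. -/
def tsign (β : Fin N → Fin N → ZMod 3) (F : Finset (Fin N)) (h g : Fin N) : ZMod 3 := if LocTwin β F h g then 1 else -1

/-- Size of the effective-offset group `t` of the surviving class: `#{h ∈ surv : ε_h·(cShift_h − form β x₁ h) = t}`. -/
def grp (β : Fin N → Fin N → ZMod 3) (c : Fin N → ZMod 3) (x x₁ : Fin N → Bool) (L : List (Fin N × Fin N)) (C₀ : Finset (Fin N))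
    (g : Fin N) (t : ZMod 3) : ℕ :=
  ((surv β x x₁ L).filter fun h => tsign β (C₀ \ moveCoins L) h g * (cShift β c x₁ L h - form β x₁ h) = t).card

/-- The surviving class is BALANCED for `c`: its three effective-offset groups have sizes of equal parity. -/
def Balanced (β : Fin N → Fin N → ZMod 3) (c : Fin N → ZMod 3) (x x₁ : Fin N → Bool) (L : List (Fin N × Fin N)) (C₀ : Finset (Fin N))
    (g : Fin N) : Prop :=
  grp β c x x₁ L C₀ g 0 % 2 = grp β c x x₁ L C₀ g 1 % 2 ∧ grp β c x x₁ L C₀ g 1 % 2 = grp β c x x₁ L C₀ g 2 % 2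

/-- `surv` and `cShift` only see the pattern on the move coins. -/
theorem surv_congr (β : Fin N → Fin N → ZMod 3) (x : Fin N → Bool) {x₁ x₁' : Fin N → Bool} {L : List (Fin N × Fin N)}
    (h : ∀ q ∈ L, x₁' q.1 = x₁ q.1 ∧ x₁' q.2 = x₁ q.2) : surv β x x₁' L = surv β x x₁ L := by
  unfold surv
  refine filter_congr fun g _ => ?_
  refine forall_congr' fun q => forall_congr' fun hq => ?_
  rw [dPair_congr β (h q hq).1 (h q hq).2]

/-- Auxiliary step `cShift_congr` of Sketch29 (planner qa-qnc0-p1 g29, v3, verbatim). -/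
theorem cShift_congr (β : Fin N → Fin N → ZMod 3) (c : Fin N → ZMod 3) {x₁ x₁' : Fin N → Bool} {L : List (Fin N × Fin N)}
    (h : ∀ q ∈ L, x₁' q.1 = x₁ q.1 ∧ x₁' q.2 = x₁ q.2) : cShift β c x₁' L = cShift β c x₁ L := by
  funext g
  unfold cShift
  congr 2
  exact List.map_congr_left fun q hq => dPair_congr β (h q hq).1 (h q hq).2 g

/-- A free-pair flip does not touch the move coins. -/
theorem flip_free_agrees {C₀ : Finset (Fin N)} {L : List (Fin N × Fin N)} (_hL : MovesIn C₀ L) {r r' : Fin N}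
    (hr : r ∈ C₀ \ moveCoins L) (hr' : r' ∈ C₀ \ moveCoins L) (x₁ : Fin N → Bool) :
    ∀ q ∈ L, flipAt x₁ {r, r'} q.1 = x₁ q.1 ∧ flipAt x₁ {r, r'} q.2 = x₁ q.2 := by
  intro q hq
  have h1 : q.1 ∈ moveCoins L := by
    simp only [moveCoins, List.mem_toFinset, List.mem_append, List.mem_map]
    exact Or.inl ⟨q, hq, rfl⟩
  have h2 : q.2 ∈ moveCoins L := by
    simp only [moveCoins, List.mem_toFinset, List.mem_append, List.mem_map]
    exact Or.inr ⟨q, hq, rfl⟩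
  have hr1 := (mem_sdiff.1 hr).2
  have hr2 := (mem_sdiff.1 hr').2
  have n1 : q.1 ∉ ({r, r'} : Finset (Fin N)) := by
    simp only [mem_insert, mem_singleton, not_or]
    exact ⟨fun e => hr1 (e ▸ h1), fun e => hr2 (e ▸ h1)⟩
  have n2 : q.2 ∉ ({r, r'} : Finset (Fin N)) := by
    simp only [mem_insert, mem_singleton, not_or]
    exact ⟨fun e => hr1 (e ▸ h2), fun e => hr2 (e ▸ h2)⟩
  exact ⟨flipAt_apply_of_not_mem n1, flipAt_apply_of_not_mem n2⟩

/-- `dPair` of a local `±`-twin on a free pair. -/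
theorem dPair_tsign (β : Fin N → Fin N → ZMod 3) (x₁ : Fin N → Bool) {F : Finset (Fin N)} {h g r r' : Fin N}
    (htw : LocTwin β F h g ∨ LocAnti β F h g) (hr : r ∈ F) (hr' : r' ∈ F) :
    dPair β x₁ h r r' = tsign β F h g * dPair β x₁ g r r' := by
  unfold tsign
  by_cases ht : LocTwin β F h g
  · rw [if_pos ht, one_mul]
    unfold dPair
    rw [ht r hr, ht r' hr']
  · rw [if_neg ht]
    have ha : LocAnti β F h g := htw.resolve_left ht
    unfold dPair
    rw [ha r hr, ha r' hr']
    split_ifs <;> ring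

/-- `tsign` is `±1`. -/
theorem tsign_sq (β : Fin N → Fin N → ZMod 3) (F : Finset (Fin N)) (h g : Fin N) : tsign β F h g * tsign β F h g = 1 := by
  unfold tsign
  split_ifs <;> decide

/-- The three groups partition the surviving class. -/
theorem grp_sum (β : Fin N → Fin N → ZMod 3) (c : Fin N → ZMod 3) (x x₁ : Fin N → Bool) (L : List (Fin N × Fin N))
    (C₀ : Finset (Fin N)) (g : Fin N) :
    grp β c x x₁ L C₀ g 0 + grp β c x x₁ L C₀ g 1 + grp β c x x₁ L C₀ g 2 = (surv β x x₁ L).card := by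
  unfold grp
  rw [card_filter, card_filter, card_filter, ← sum_add_distrib, ← sum_add_distrib, card_eq_sum_ones]
  refine sum_congr rfl fun h _ => ?_
  generalize tsign β (C₀ \ moveCoins L) h g * (cShift β c x₁ L h - form β x₁ h) = v
  revert v
  decide

/-- Firing count of the class at `x₁` = group `0`; at the free-pair partner = group `d`. -/
theorem fires_eq_grp (β : Fin N → Fin N → ZMod 3) (c : Fin N → ZMod 3) (x x₁ : Fin N → Bool) (L : List (Fin N × Fin N))
    (C₀ : Finset (Fin N)) (g : Fin N) :
    fires β (cShift β c x₁ L) (surv β x x₁ L) x₁ = grp β c x x₁ L C₀ g 0 := by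
  unfold fires grp
  congr 1
  refine filter_congr fun h _ => ?_
  have hs := tsign_sq β (C₀ \ moveCoins L) h g
  generalize tsign β (C₀ \ moveCoins L) h g = s at hs ⊢
  generalize cShift β c x₁ L h = a
  generalize form β x₁ h = b
  revert s a b
  decide

/-- Auxiliary step `fires_partner_eq_grp` of Sketch29 (planner qa-qnc0-p1 g29, v3, verbatim). -/
theorem fires_partner_eq_grp (β : Fin N → Fin N → ZMod 3) (c : Fin N → ZMod 3) {x : Fin N → Bool} {C₀ : Finset (Fin N)}
    {x₁ : Fin N → Bool} {L : List (Fin N × Fin N)} {g r r' : Fin N} (h : IsClassIsoPair β x C₀ x₁ L g r r') :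
    fires β (cShift β c x₁ L) (surv β x x₁ L) (flipAt x₁ {r, r'}) = grp β c x x₁ L C₀ g (dPair β x₁ g r r') := by
  obtain ⟨-, -, hL, -, htw, hr, hr', hrr', -⟩ := h
  unfold fires grp
  congr 1
  refine filter_congr fun k hk => ?_
  rw [form_flipAt_pair β x₁ k hrr', dPair_tsign β x₁ (htw k hk) hr hr']
  have hs := tsign_sq β (C₀ \ moveCoins L) k g
  generalize tsign β (C₀ \ moveCoins L) k g = s at hs ⊢
  generalize cShift β c x₁ L k = a
  generalize form β x₁ k = b
  generalize dPair β x₁ g r r' = d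
  revert s a b d
  decide

/-- **UNBALANCED CLASS ⇒ CUBE WITNESS (PROVED, pointwise, every `c`).** -/
theorem cube_of_unbalanced (hN : 3 ≤ N) (β : Fin N → Fin N → ZMod 3) (c : Fin N → ZMod 3) {x : Fin N → Bool} {C₀ : Finset (Fin N)}
    (hC₀ : C₀ ⊆ klineZeros x) {x₁ : Fin N → Bool} {L : List (Fin N × Fin N)} {g r r' : Fin N} (h : IsClassIsoPair β x C₀ x₁ L g r r')
    (hb : ¬ Balanced β c x x₁ L C₀ g) : CubeWitness β c x C₀ := by
  have h' := h
  obtain ⟨hx₁, hL0, hL, -, -, hr, hr', hrr', hd⟩ := h'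
  have hsum := grp_sum β c x x₁ L C₀ g
  have h0 := fires_eq_grp β c x x₁ L C₀ g
  have h1 := fires_partner_eq_grp β c h
  have hagree := flip_free_agrees hL hr hr' x₁
  have hsurv : surv β x (flipAt x₁ {r, r'}) L = surv β x x₁ L := surv_congr β x hagree
  have hcs : cShift β c (flipAt x₁ {r, r'}) L = cShift β c x₁ L := cShift_congr β c hagree
  have hmem : flipAt x₁ {r, r'} ∈ SubFibre x C₀ := flipAt_pair_mem_subFibre hN hC₀ hx₁ (mem_sdiff.1 hr).1 (mem_sdiff.1 hr').1 hrr'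
  by_contra hno
  have e0 : fires β (cShift β c x₁ L) (surv β x x₁ L) x₁ % 2 = (surv β x x₁ L).card % 2 := by
    by_contra hne
    exact hno ⟨x₁, hx₁, L, hL0, hL, hne⟩
  have e1 : fires β (cShift β c x₁ L) (surv β x x₁ L) (flipAt x₁ {r, r'}) % 2 = (surv β x x₁ L).card % 2 := by
    by_contra hne
    refine hno ⟨flipAt x₁ {r, r'}, hmem, L, hL0, hL, ?_⟩
    rw [hsurv, hcs]
    exact hne
  rw [h0] at e0
  rw [h1] at e1
  have hd12 : dPair β x₁ g r r' = 1 ∨ dPair β x₁ g r r' = 2 := by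
    revert hd
    generalize dPair β x₁ g r r' = d
    revert d
    decide
  unfold Balanced at hb
  rcases hd12 with hd1 | hd2
  · rw [hd1] at e1
    omega
  · rw [hd2] at e1
    omega

/-- A single survivor is never balanced. -/
theorem not_balanced_single (β : Fin N → Fin N → ZMod 3) (c : Fin N → ZMod 3) {x x₁ : Fin N → Bool} {L : List (Fin N × Fin N)}
    {C₀ : Finset (Fin N)} {g : Fin N} (hs : surv β x x₁ L = {g}) : ¬ Balanced β c x x₁ L C₀ g := by
  intro hb
  have hsum := grp_sum β c x x₁ L C₀ g
  rw [hs, card_singleton] at hsum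
  unfold Balanced at hb
  omega

/-- **SINGLE SURVIVOR ⇒ CUBE WITNESS FOR EVERY `c` (PROVED).** -/
theorem cube_of_single (hN : 3 ≤ N) (β : Fin N → Fin N → ZMod 3) {x : Fin N → Bool} {C₀ : Finset (Fin N)} (hC₀ : C₀ ⊆ klineZeros x)
    {x₁ : Fin N → Bool} {L : List (Fin N × Fin N)} {g r r' : Fin N} (h : IsClassIsoPair β x C₀ x₁ L g r r')
    (hs : surv β x x₁ L = {g}) (c : Fin N → ZMod 3) : CubeWitness β c x C₀ :=
  cube_of_unbalanced hN β c hC₀ h (not_balanced_single β c hs)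

/-- The data of a CLASS ISOLATION at `(x, C₀)` (c-free, PATTERN-ROBUST form): as `IsClassIsoPair`, but instead of a non-degenerate pair,
THREE distinct free coins read by `g` — then EVERY pattern has a non-degenerate free pair among them (`exists_pair_of_three`), so the structure
survives a change of the parity class of the pattern (needed by the toggle of layer B). -/
def IsClassIso (β : Fin N → Fin N → ZMod 3) (x : Fin N → Bool) (C₀ : Finset (Fin N)) (x₁ : Fin N → Bool) (L : List (Fin N × Fin N))
    (g : Fin N) : Prop :=
  x₁ ∈ SubFibre x C₀ ∧ L ≠ [] ∧ MovesIn C₀ L ∧ g ∈ surv β x x₁ L ∧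
    (∀ h ∈ surv β x x₁ L, LocTwin β (C₀ \ moveCoins L) h g ∨ LocAnti β (C₀ \ moveCoins L) h g) ∧
    ∃ r ∈ C₀ \ moveCoins L, ∃ r' ∈ C₀ \ moveCoins L, ∃ r'' ∈ C₀ \ moveCoins L,
      r ≠ r' ∧ r ≠ r'' ∧ r' ≠ r'' ∧ β g r ≠ 0 ∧ β g r' ≠ 0 ∧ β g r'' ≠ 0

/-- Among three coins read by `g`, every pattern has a non-degenerate pair (two of three signed values in `{±1}` agree; their sum is `≠ 0`). -/
theorem exists_pair_of_three (β : Fin N → Fin N → ZMod 3) (x₁ : Fin N → Bool) {g r r' r'' : Fin N} (h1 : β g r ≠ 0) (h2 : β g r' ≠ 0)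
    (h3 : β g r'' ≠ 0) : dPair β x₁ g r r' ≠ 0 ∨ dPair β x₁ g r r'' ≠ 0 ∨ dPair β x₁ g r' r'' ≠ 0 := by
  unfold dPair
  revert h1 h2 h3
  generalize β g r = a
  generalize β g r' = b
  generalize β g r'' = e
  generalize x₁ r = p
  generalize x₁ r' = q
  generalize x₁ r'' = w
  revert a b e p q w
  decide

/-- The pattern-robust structure yields a non-degenerate pair for the pattern at hand. -/
theorem isClassIsoPair_of {β : Fin N → Fin N → ZMod 3} {x : Fin N → Bool} {C₀ : Finset (Fin N)} {x₁ : Fin N → Bool}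
    {L : List (Fin N × Fin N)} {g : Fin N} (h : IsClassIso β x C₀ x₁ L g) : ∃ r r' : Fin N, IsClassIsoPair β x C₀ x₁ L g r r' := by
  obtain ⟨hx₁, hL0, hL, hg, htw, r, hr, r', hr', r'', hr'', hrr', hrr'', hr'r'', h1, h2, h3⟩ := h
  rcases exists_pair_of_three β x₁ h1 h2 h3 with hd | hd | hd
  · exact ⟨r, r', hx₁, hL0, hL, hg, htw, hr, hr', hrr', hd⟩
  · exact ⟨r, r'', hx₁, hL0, hL, hg, htw, hr, hr'', hrr'', hd⟩
  · exact ⟨r', r'', hx₁, hL0, hL, hg, htw, hr', hr'', hr'r'', hd⟩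

/-- **UNBALANCED CLASS ⇒ CUBE WITNESS**, pattern-robust form (PROVED). -/
theorem cube_of_unbalanced' (hN : 3 ≤ N) (β : Fin N → Fin N → ZMod 3) (c : Fin N → ZMod 3) {x : Fin N → Bool} {C₀ : Finset (Fin N)}
    (hC₀ : C₀ ⊆ klineZeros x) {x₁ : Fin N → Bool} {L : List (Fin N × Fin N)} {g : Fin N} (h : IsClassIso β x C₀ x₁ L g)
    (hb : ¬ Balanced β c x x₁ L C₀ g) : CubeWitness β c x C₀ := by
  obtain ⟨r, r', hp⟩ := isClassIsoPair_of h
  exact cube_of_unbalanced hN β c hC₀ hp hb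

/-- **SINGLE SURVIVOR ⇒ CUBE WITNESS FOR EVERY `c`**, pattern-robust form (PROVED). -/
theorem cube_of_single' (hN : 3 ≤ N) (β : Fin N → Fin N → ZMod 3) {x : Fin N → Bool} {C₀ : Finset (Fin N)} (hC₀ : C₀ ⊆ klineZeros x)
    {x₁ : Fin N → Bool} {L : List (Fin N × Fin N)} {g : Fin N} (h : IsClassIso β x C₀ x₁ L g) (hs : surv β x x₁ L = {g})
    (c : Fin N → ZMod 3) : CubeWitness β c x C₀ :=
  cube_of_unbalanced' hN β c hC₀ h (not_balanced_single β c hs)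

/-! #### The corrected split of `HCube` (conjectures `HClassA`, `HClassB`; composition PROVED)

`HClassA` (c-free, game-free; pure combinatorics of `β` against the kernel-line law): far from every frame ⇒ for some `Z ≤ K·log₂N` there is a
STABLE window law carrying mass `≥ N^{-a}·2^{N-1}` on class isolations WITH A FREE MEMBER (a survivor `u` whose two ring-neighbours are active
and at whose three positions `u-1, u, u+1` the whole class is still `±`-twin to `g`).  Candidate law: the HOST-ROW law (uniform over hosts `g`
with `≥ 2Z` coins in `supp β_g ∖ {g}`, then uniform `Z`-subsets of those coins), with sign-steered halving moves inside the window.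
`HClassB` (the parity step, every `c`): under a stable law, class-isolation mass `N^{-a}` ⇒ cube-witness law-density `N^{-(a+b)}`.  **PROVED
in §29.6–29.7** (`hClassB`, with `b = K + 2`): a BALANCED class with free member `u` becomes UNBALANCED when `u` is made a coin (`x ↦ x ⊕ e_{u-1} ⊕ e_{u+1}`,
the pair-creation move `Fib19.kline_create`); the class data survive (moves and free coins live in `C₀`, the twin relation at `u±1` makes the shift of
all remaining effective offsets common), the law loses at most the factor `Z+1` (`StableLaw`), and summing over `u` with the involution `x ↦ x ⊕ P_u`
re-indexes the mass: `mass ClassIsoFM ≤ (1 + N(Z+1))·mass CubeWitness`.  So (NP₁) hangs on `HClassA` ALONE (`polyLoss_of_classA`). -/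

/-- FREE MEMBER of the surviving class (c-free): a survivor `u ≠ g` whose two ring-neighbours are active and at which neighbours every OTHER
member of the class is still `±`-twin to `g` (same sign as on the free coins; no condition on row `u` itself, which leaves the class).  Making `u`
a coin (§29.6) removes `u` from the class and shifts all remaining effective offsets equally. -/
def FreeMember (β : Fin N → Fin N → ZMod 3) (x x₁ : Fin N → Bool) (L : List (Fin N × Fin N)) (C₀ : Finset (Fin N)) (g : Fin N) : Prop :=
  ∃ u ∈ surv β x x₁ L, u ≠ g ∧ kline x (prv u) = true ∧ kline x (nxt u) = true ∧
    ∀ h ∈ surv β x x₁ L, h ≠ u → LocTwin β (insert (prv u) (insert (nxt u) (C₀ \ moveCoins L))) h g ∨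
      LocAnti β (insert (prv u) (insert (nxt u) (C₀ \ moveCoins L))) h g

/-- CLASS ISOLATION, SINGLE OR WITH A FREE MEMBER, at `(x, C₀)` — the c-free certificate of layer A (as a `W`, it ignores `c`).
(A single survivor needs no free member: its class is never balanced, `not_balanced_single`.) -/
def ClassIsoFM (β : Fin N → Fin N → ZMod 3) (_c : Fin N → ZMod 3) (x : Fin N → Bool) (C₀ : Finset (Fin N)) : Prop :=
  ∃ (x₁ : Fin N → Bool) (L : List (Fin N × Fin N)) (g : Fin N), IsClassIso β x C₀ x₁ L g ∧
    (surv β x x₁ L = {g} ∨ FreeMember β x x₁ L C₀ g)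

/-- A STABLE window law: creating one coin outside the window divides the weight by at most `Z + 1` (true for host-row laws). -/
def StableLaw (Z : ℕ) (ω : (Fin N → Bool) → Finset (Fin N) → ℝ) : Prop :=
  WindowLaw Z ω ∧ ∀ (J : Fin N → Bool) (u : Fin N) (C₀ : Finset (Fin N)), u ∉ C₀ → ω J C₀ ≤ (Z + 1) * ω (Function.update J u false) C₀

/-- **Layer A (THE conjecture, c-free): far from every frame ⇒ some stable `Z`-window law with `Z ≤ K·log₂N` puts mass `≥ N^{-a}·2^{N-1}` on
class isolations that are single or have a free member.**  Why it might fail: a far strategy all of whose rows of weight `≥ 2Z` have, on every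
`Z`-window inside their support, a co-surviving partial twin reading all but one free coin (then no steering kills it) — near-twin CLUSTERS of
high rank; or banded strategies whose isolated classes are never single and whose members all read their own ring-neighbours (no free member).
**FALSE AS TYPED** (run-twins RT₈ / window-pure RT₆⋆: qn-lit g29 L-36 C–F, accepted by qn-p1 g29 ROUND-28 §5A ERRATUM 2, 2026-08-28) —
kept as a named negative; do not target.  The live (NP₁) reductions are `AffBells29.polyLoss_of_hWide` / `polyLoss_of_hAbs`
(`AffBells29Transfer.lean`). -/
def HClassA : Prop :=
  ∃ δ₀ : ℝ, δ₀ < 1 / 2 ∧ ∃ r₀ w₀ a K N₀ : ℕ, ∀ N ≥ N₀, ∀ (β : Fin N → Fin N → ZMod 3), ¬ FrameDecomp δ₀ r₀ w₀ β →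
    ∃ Z ≤ K * Nat.log 2 N, ∃ ω : (Fin N → Bool) → Finset (Fin N) → ℝ, StableLaw Z ω ∧
      ∀ c : Fin N → ZMod 3, (1 : ℝ) / (N : ℝ) ^ a * (2 : ℝ) ^ (N - 1) ≤ mass @ClassIsoFM Z ω β c

/-- **Layer B (the parity step) — no longer a conjecture: PROVED below as `hClassB` (§29.7).** -/
def HClassB : Prop :=
  ∀ a K : ℕ, ∃ b N₀ : ℕ, ∀ N ≥ N₀, ∀ Z ≤ K * Nat.log 2 N, ∀ ω : (Fin N → Bool) → Finset (Fin N) → ℝ, StableLaw Z ω →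
    ∀ (β : Fin N → Fin N → ZMod 3) (c : Fin N → ZMod 3), (1 : ℝ) / (N : ℝ) ^ a * (2 : ℝ) ^ (N - 1) ≤ mass @ClassIsoFM Z ω β c →
      ∃ Z' ≤ (K + b) * Nat.log 2 N, LawDense @CubeWitness ((1 : ℝ) / (N : ℝ) ^ (a + b)) Z' β c

/-- PROVED: the two layers give `HCube` (exponents `a + b`, `K + b`). -/
theorem hCube_of_classAB (hA : HClassA) (hB : HClassB) : HCube := by
  obtain ⟨δ₀, hδ₀, r₀, w₀, a, K, N₀, hA'⟩ := hA
  obtain ⟨b, N₁, hB'⟩ := hB a K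
  refine ⟨δ₀, hδ₀, r₀, w₀, a + b, K + b, max N₀ N₁, fun N hN β c hfar => Or.inr ?_⟩
  obtain ⟨Z, hZ, ω, hω, hm⟩ := hA' N (le_trans (le_max_left _ _) hN) β hfar
  exact hB' N (le_trans (le_max_right _ _) hN) Z hZ ω hω β c (hm c)

/-- **(NP₁) from the corrected split (PROVED modulo the two conjectures).** -/
theorem polyLoss_of_classAB (hA : HClassA) (hB : HClassB) : AffBellsPolyLoss3 := polyLoss_of_cube (hCube_of_classAB hA hB)

end AffBells29

end Summit.QuantumAdvantage.AdviceFreeQNC0
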